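import Literature.NumberTheory.EllipticCurves.BinaryQuarticReductionProofs
import Literature.NumberTheory.EllipticCurves.BinaryQuarticDiscriminantStrata
import Literature.NumberTheory.EllipticCurves.BhargavaShankarClassCountProofs
import Mathlib.FieldTheory.Perfect
import HarnessLib

/-!
# An irreducible integral binary quartic form has nonzero discriminant; finiteness of all the
# class counts `N(S; X)`

`Proofs` companion of `BinaryQuarticForms.lean` (theorems only: no definitions, no named facts).
Bhargava–Shankar count `GL₂(ℤ)`-classes of *irreducible* integral binary quartic forms
(*Binary quartic forms having bounded invariants, and the boundedness of the average rank of
elliptic curves*, Ann. of Math. (2) 181 (2015) 191–242, Thm 2.1) inside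
`V_ℤ^{(0)} ⊔ V_ℤ^{(1)} ⊔ V_ℤ^{(2)}`, the forms of nonzero discriminant (§2.1: "`V_ℝ^{(i)}` denote[s]
the set of points in `V_ℝ` having nonzero discriminant and …" in the published version; the real
types are defined by root counting, which presupposes `Δ ≠ 0`). That an irreducible form
automatically has `Δ ≠ 0` is used tacitly; here it is proved, and combined with
`BinaryQuarticReductionProofs.finite_gl2zOrbits` it gives the finiteness of the orbit sets behind
`N(S; X)` for every `S ⊆ V_ℤ`.

## Contents (all proved)

* `toPoly_map`: `(f.map φ)(x,1) = f(x,1).map φ`.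
* `disc_ne_zero_of_isIrreducible`: **an irreducible integral form has `Δ ≠ 0`** — over `ℂ`,
  `f = a ∏ (x − rᵢ y)` (`exists_eq_ofRoots`) and `Δ = a⁶ ∏_{i<j} (rᵢ − rⱼ)²` (`disc_ofRoots`); a
  repeated root `r` is a common zero of `f(x,1)` and `∂f/∂x(x,1)`, impossible since the irreducible
  `f(x,1) ∈ ℚ[X]` is separable (`PerfectField.separable_of_irreducible`,
  `Separable.eval₂_derivative_ne_zero`).
* `mem_realTypes_of_isIrreducible`: an irreducible form lies in `V_ℤ^{(0)} ∪ V_ℤ^{(1)} ∪ V_ℤ^{(2)}`.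
* `finite_gl2zOrbits_of_isIrreducible`, `finite_gl2zOrbits_any`: for every `S` and `X`, the set of
  orbits `{GL₂(ℤ)f : f ∈ S irreducible, H(f) < X}` — whose `Set.ncard` is `gl2zClassCount S X` — is
  finite; `gl2zClassCount_mono`, `gl2zClassCount_mono_right`; `pgl2Traces_finite_unconditional`
  (the `PGL₂(ℚ)`-classes with prescribed invariants are finitely many, for every `(A, B)`).

## References

* M. Bhargava, A. Shankar, Ann. of Math. (2) 181 (2015) 191–242 = arXiv:1006.1002, Thm 2.1 and
  §2.1. [cite: BhargavaShankarAnnals2015, Thm 2.1 and §2.1 (arXiv:1006.1002v2 numbering)]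
-/

noncomputable section

open scoped Classical
open Polynomial

namespace Literature.NumberTheory.EllipticCurves

namespace BinaryQuartic

section General

variable {R S : Type*} [CommRing R] [CommRing S]

/-- `toPoly` commutes with change of ring: `(f.map φ)(x,1) = f(x,1).map φ`. [folklore] -/
theorem toPoly_map (φ : R →+* S) (f : BinaryQuartic R) : (f.map φ).toPoly = f.toPoly.map φ := by
  simp only [toPoly, map, Polynomial.map_add, Polynomial.map_mul, Polynomial.map_pow, map_C, map_X]

/-- `f(x,1)` for `f = a ∏ (x − rᵢ y)`: `a ∏ (x − rᵢ)`. [folklore] -/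
theorem eval_toPoly_ofRoots (a r₁ r₂ r₃ r₄ x : R) :
    (ofRoots a r₁ r₂ r₃ r₄).toPoly.eval x = a * (x - r₁) * (x - r₂) * (x - r₃) * (x - r₄) := by
  rw [eval_toPoly, eval_ofRoots]; ring

/-- `∂f/∂x (x,1)` for `f = a ∏ (x − rᵢ y)` (product rule). [folklore] -/
theorem eval_derivative_toPoly_ofRoots (a r₁ r₂ r₃ r₄ x : R) :
    (ofRoots a r₁ r₂ r₃ r₄).toPoly.derivative.eval x =
      a * ((x - r₂) * (x - r₃) * (x - r₄) + (x - r₁) * (x - r₃) * (x - r₄) +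
        (x - r₁) * (x - r₂) * (x - r₄) + (x - r₁) * (x - r₂) * (x - r₃)) := by
  rw [eval_derivative_toPoly]; simp only [ofRoots]; ring

end General

/-- **An irreducible integral binary quartic form has nonzero discriminant** (irreducible over `ℚ`
in degree `4` ⇒ separable ⇒ no repeated root over `ℂ` ⇒ `Δ = a⁶∏_{i<j}(rᵢ − rⱼ)² ≠ 0`); tacit in
Bhargava–Shankar 2015, Thm 2.1, where irreducible forms are counted inside
`V_ℤ^{(0)} ⊔ V_ℤ^{(1)} ⊔ V_ℤ^{(2)} = {Δ ≠ 0}`. [cite: BhargavaShankarAnnals2015, Thm 2.1 and §2.1 (arXiv:1006.1002v2 numbering)] -/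
theorem disc_ne_zero_of_isIrreducible {f : BinaryQuartic ℤ} (hf : f.IsIrreducible) : f.disc ≠ 0 := by
  intro hdisc
  -- over `ℂ`: `f = a ∏ (x − rᵢ y)` and `∏_{i<j} (rᵢ − rⱼ) = 0`
  set fC : BinaryQuartic ℂ := f.map (Int.castRingHom ℂ) with hfCdef
  have haC : fC.a ≠ 0 := by
    rw [hfCdef, map_a, eq_intCast, Int.cast_ne_zero]; exact hf.1
  obtain ⟨a, r₁, r₂, r₃, r₄, ha, hfC⟩ := exists_eq_ofRoots fC haC
  have hdiscC : fC.disc = 0 := by rw [hfCdef, disc_map, hdisc, map_zero]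
  rw [hfC, disc_ofRoots] at hdiscC
  have hprod : (r₁ - r₂) * (r₁ - r₃) * (r₁ - r₄) * (r₂ - r₃) * (r₂ - r₄) * (r₃ - r₄) = 0 :=
    (pow_eq_zero_iff two_ne_zero).mp ((mul_eq_zero.mp hdiscC).resolve_left (pow_ne_zero 6 ha))
  -- `f(x,1)` is separable over `ℚ`, hence over `ℂ`
  have hsep : (f.map (Int.castRingHom ℚ)).toPoly.Separable :=
    PerfectField.separable_of_irreducible hf.2
  have hφ : (algebraMap ℚ ℂ).comp (Int.castRingHom ℚ) = Int.castRingHom ℂ := RingHom.ext_int _ _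
  have hpC : (f.map (Int.castRingHom ℚ)).toPoly.map (algebraMap ℚ ℂ) = fC.toPoly := by
    rw [← toPoly_map, map_map', hφ]
  have hsepC : fC.toPoly.Separable := hpC ▸ hsep.map
  -- a repeated root is a common zero of `f(x,1)` and its derivative: impossible
  have key : ∀ r : ℂ, fC.toPoly.eval r = 0 → fC.toPoly.derivative.eval r = 0 → False := by
    intro r h0 h1
    exact hsepC.eval₂_derivative_ne_zero (RingHom.id ℂ) (x := r) (by rw [eval₂_id]; exact h0)
      (by rw [eval₂_id]; exact h1)
  rw [hfC] at key
  simp only [mul_eq_zero, sub_eq_zero] at hprod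
  rcases hprod with ((((h | h) | h) | h) | h) | h <;> subst h
  · exact key r₁ (by rw [eval_toPoly_ofRoots]; ring) (by rw [eval_derivative_toPoly_ofRoots]; ring)
  · exact key r₁ (by rw [eval_toPoly_ofRoots]; ring) (by rw [eval_derivative_toPoly_ofRoots]; ring)
  · exact key r₁ (by rw [eval_toPoly_ofRoots]; ring) (by rw [eval_derivative_toPoly_ofRoots]; ring)
  · exact key r₂ (by rw [eval_toPoly_ofRoots]; ring) (by rw [eval_derivative_toPoly_ofRoots]; ring)
  · exact key r₂ (by rw [eval_toPoly_ofRoots]; ring) (by rw [eval_derivative_toPoly_ofRoots]; ring)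
  · exact key r₃ (by rw [eval_toPoly_ofRoots]; ring) (by rw [eval_derivative_toPoly_ofRoots]; ring)

/-- An irreducible integral form lies in `V_ℤ^{(0)} ∪ V_ℤ^{(1)} ∪ V_ℤ^{(2)}`
(`fourRealRoots ∪ twoRealRoots ∪ noRealRoots`), the partition of `{Δ ≠ 0}` by real type
(Bhargava–Shankar 2015, §2.1). [cite: BhargavaShankarAnnals2015, §2.1] -/
theorem mem_realTypes_of_isIrreducible {f : BinaryQuartic ℤ} (hf : f.IsIrreducible) :
    f ∈ fourRealRoots ∨ f ∈ twoRealRoots ∨ f ∈ noRealRoots :=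
  mem_realTypes_of_disc_ne_zero (disc_ne_zero_of_isIrreducible hf)

/-- **Finiteness of the class counts for all irreducible forms**: for every `X`, the set of
`GL₂(ℤ)`-orbits of irreducible integral binary quartic forms of height `< X` is finite
(`finite_gl2zOrbits` of `BinaryQuarticReductionProofs`, the hypothesis "`Δ ≠ 0` or definite"
being automatic). [cite: BhargavaShankarAnnals2015, Thm 2.1 and §2.1–2.3 (arXiv:1006.1002v2 numbering)] -/
theorem finite_gl2zOrbits_of_isIrreducible (X : ℝ) :
    (gl2zOrbit '' {f : BinaryQuartic ℤ | f.IsIrreducible ∧ f.height < X}).Finite :=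
  (finite_gl2zOrbits X).subset
    (Set.image_mono fun _ hf ↦ ⟨Or.inl (disc_ne_zero_of_isIrreducible hf.1), hf⟩)

/-- For every set `S` of integral forms and every `X`, the orbit set whose cardinality is
`N(S; X) = gl2zClassCount S X` is finite; so `gl2zClassCount` never takes its junk value.
[cite: BhargavaShankarAnnals2015, Thm 2.1 (N(S;X); arXiv:1006.1002v2 numbering)] -/
theorem finite_gl2zOrbits_any (S : Set (BinaryQuartic ℤ)) (X : ℝ) :
    (gl2zOrbit '' {f : BinaryQuartic ℤ | f ∈ S ∧ f.IsIrreducible ∧ f.height < X}).Finite :=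
  (finite_gl2zOrbits_of_isIrreducible X).subset (Set.image_mono fun _ hf ↦ hf.2)

/-- `N(S; X)` is monotone in `S`. [folklore] -/
theorem gl2zClassCount_mono {S T : Set (BinaryQuartic ℤ)} (h : S ⊆ T) (X : ℝ) :
    gl2zClassCount S X ≤ gl2zClassCount T X :=
  Set.ncard_le_ncard (Set.image_mono fun _ hf ↦ ⟨h hf.1, hf.2⟩) (finite_gl2zOrbits_any T X)

/-- `N(S; X)` is monotone in `X`. [folklore] -/
theorem gl2zClassCount_mono_right (S : Set (BinaryQuartic ℤ)) {X X' : ℝ} (h : X ≤ X') :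
    gl2zClassCount S X ≤ gl2zClassCount S X' :=
  Set.ncard_le_ncard (Set.image_mono fun _ hf ↦ ⟨hf.1, hf.2.1, hf.2.2.trans_le h⟩)
    (finite_gl2zOrbits_any S X')

/-- **Finiteness of the `PGL₂(ℚ)`-classes of locally soluble irreducible forms with prescribed
invariants**, unconditionally: the conclusion of `pgl2Traces_finite`
(`BhargavaShankarClassCountProofs`) for *every* `(A, B)`, without its hypothesis
`bhargavaShankar_classCount` (there Thm 2.1 was only used for the finiteness of the orbit sets;
all the forms in question have height `2¹⁰·27·H(E_{A,B})`, `height_eq_of_invariants_eq`). With it,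
the hypothesis `h16` of `sum_pgl2QClassCount_eq_locSolIrredClassCount` is likewise superfluous.
[cite: BhargavaShankarAnnals2015, Thm 2.1 and §5.4 (arXiv:1006.1002v2 numbering)] -/
theorem pgl2Traces_finite_unconditional (AB : ℤ × ℤ) :
    ((fun f ↦ {g | g ∈ {f : BinaryQuartic ℤ | f.IsLocallySoluble ∧ f.IsIrreducible ∧
        f.I = 2 ^ 4 * (-3 * AB.1) ∧ f.J = 2 ^ 6 * (-27 * AB.2)} ∧
        PGL2Equiv (f.map (Int.castRingHom ℚ)) (g.map (Int.castRingHom ℚ))}) ''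
      {f : BinaryQuartic ℤ | f.IsLocallySoluble ∧ f.IsIrreducible ∧
        f.I = 2 ^ 4 * (-3 * AB.1) ∧ f.J = 2 ^ 6 * (-27 * AB.2)}).Finite := by
  apply pgl2Traces_finite_of_orbits_finite
  set Y : ℝ := 2 ^ 10 * 27 * (naiveHeight (AB.1, AB.2) : ℝ) + 1 with hY
  refine (finite_gl2zOrbits_of_isIrreducible Y).subset ?_
  rintro _ ⟨f, ⟨-, hirr, hI, hJ⟩, rfl⟩
  refine ⟨f, ⟨hirr, ?_⟩, rfl⟩
  rw [hY, height_eq_of_invariants_eq hI hJ]; linarith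

end BinaryQuartic

end Literature.NumberTheory.EllipticCurves

end
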